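import Summits.NavierStokesRegularity.NavierStokesRegularity.Theorems.StretchingWellBindingEnstrophyQuarterLawStretchingSplitSlice
import Summits.NavierStokesRegularity.NavierStokesRegularity.Theorems.StretchingWellBindingEnstrophyQuarterLawStretchingSplitODE
import Summits.NavierStokesRegularity.NavierStokesRegularity.Theorems.StretchingWellBindingEnstrophyQuarterLawEarlySlab
import Summits.NavierStokesRegularity.NavierStokesRegularity.Theorems.EfficiencyFloorEnstrophyBudget
import HarnessLib

/-!
# Shelf 1574, LINE 7 twin `lamb_budget_vorticity`: the ENGINE `stub_stretchingSplit : StretchingSplit`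
# (gradient Type I + volume sparseness of the high-vorticity set ⇒ the slice quarter law)

Helper file (`--supports stmt-NavierStokesRegularity-1574 --as helper`). The engine stub of ns-idea-9's LINE 7 TWIN
`Cruxes/EnstrophyQuarterLaw/Lines/lamb_budget_vorticity.lean` (b61a884b4856; idea-crit-8 V30a PASS probes, "TRUE (M)";
N35: "ODE half PROVED in Lean; remaining content = the pointwise split + Tonelli"), signature VERBATIM with the
Cruxes-local predicates `GradientTypeI`, `VorticitySparse`/`vortexSet`, `SliceLaw` unfolded: for every threshold
`c₂ ∈ (0, 1/4)`, every `ν, T > 0` and every maximal classical Leray–Hopf solution `u` on `[0,T)` from a rapidly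
decaying datum, the gradient Type-I rate `‖∇u(t)‖_∞ ≤ G/(T−t)` near `T` together with the volume bound
`|{x : |curl u(s,x)| > c₂/(T−s)}| ≤ N (ν(T−s))^{3/2}` for `s ∈ [0,T)` imply the slice quarter law
`∫ |curl u(t)|² ≤ K/√(T−t)` on `[0,T)`.

PROOF (as on the twin's card, with the crude bound `|ω·Sω| ≤ |ω|² ‖∇u‖`, hence `a = 2c₂ < 1/2`).
(1) Enstrophy budget (tree, stmt-22995 `Theorems.EnstrophyBudget.main`): on `(0,T)`, `Z = ∫|ω|²` has
`Z′ = 2S − 2νP ≤ 2S`, `S = ∫⟪ω, ∇u ω⟫`. (2) One-slice stretching split (`stretch_le_split`, file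
`…StretchingSplitSlice`): on the rate window, `S(s) ≤ (c₂/(T−s)) Z(s) + |W(s)| ‖curlCLM‖² (G/(T−s))³`, and
`|W(s)| ≤ N (ν(T−s))^{3/2}` makes the second term `M₀ (T−s)^{−3/2}`, `M₀ = N ν^{3/2} ‖curlCLM‖² G³`.
(3) ODE half (`sliceBound_of_absorbedGrowth_from`, file `…StretchingSplitODE`, = ns-idea-9 g3's kernel lemma
shifted to the window's left endpoint `t₀`): `Z(t) ≤ (√(T−t₀) Z(t₀) + 2M₀/(1/2 − 2c₂))/√(T−t)` on `[t₀,T)`.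
(4) Below `t₀` the early-slab bound (`SparseSieve.earlySlab_enstrophy_bound`, Tao 2011 Cor. 11.1) and
`√(T−t) ≤ √T`. `K := max(√(T−t₀) Z(t₀) + 2M₀/(1/2−2c₂), B₀√T)`.

HONEST FRAMING: bookkeeping about ONE hypothetical blow-up under two velocity-side hypotheses (the Type-I gradient
rate — a consequence of 0056 by `gradientTypeIOfTypeI` — and the twin's crux B_ω `VorticitySparsenessLaw`); nothing
here bears on the regularity problem; `EnstrophyQuarterLaw` (1574), 0056 and B_ω stay OPEN. No summit statement
is proved.
-/

noncomputable section

-- the summit-side namespace repeats a component by design (D-0017)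
set_option linter.dupNamespace false

namespace Summit.NavierStokesRegularity.NavierStokesRegularity.Theorems.EnstrophyQuarterLaw.LambBudget

open Set MeasureTheory Filter Topology
open scoped RealInnerProductSpace ENNReal NNReal
open Literature.Analysis.FluidPDE

/-- `√r³ = r³ · r^{−3/2}` for `r > 0` (exponent bookkeeping for the forcing term). [folklore] -/
theorem sqrt_pow_three_eq_mul_rpow {r : ℝ} (hr : 0 < r) :
    Real.sqrt r ^ 3 = r ^ 3 * r ^ (-(3 : ℝ) / 2) := by
  rw [Real.sqrt_eq_rpow, ← Real.rpow_natCast (r ^ (1 / 2 : ℝ)) 3, ← Real.rpow_mul hr.le,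
    ← Real.rpow_natCast r 3, ← Real.rpow_add hr]
  norm_num

/-- **`StretchingSplit` of `Lines/lamb_budget_vorticity.lean` (stub `stub_stretchingSplit`, signature VERBATIM with
`GradientTypeI`, `VorticitySparse`, `vortexSet`, `SliceLaw` unfolded).** Gradient Type I near `T` plus volume
sparseness of the high-vorticity set `{|curl u(s)| > c₂/(T−s)}` at a threshold `c₂ < 1/4` imply the slice quarter
law `∫ |curl u(t)|² ≤ K/√(T−t)` on `[0,T)`, for a maximal classical Leray–Hopf solution from a rapidly decaying
datum. [folklore] -/
theorem stretchingSplit :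
    ∀ c₂ : ℝ, 0 < c₂ → c₂ < 1 / 4 →
    ∀ (ν T : ℝ), 0 < ν → 0 < T →
    ∀ (u : ℝ → EuclideanSpace ℝ (Fin 3) → EuclideanSpace ℝ (Fin 3)) (p : ℝ → EuclideanSpace ℝ (Fin 3) → ℝ),
      IsMaximalSmoothSolution ν 0 u p T → IsLerayHopfOn T ν 0 (u 0) u → HasRapidSpatialDecay (u 0) →
      (∃ C : ℝ, ∀ᶠ t in nhdsWithin T (Set.Iio T), ∀ x, ‖fderiv ℝ (u t) x‖ ≤ C / (T - t)) →
      (∃ N : ℝ, ∀ s ∈ Set.Ico 0 T,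
        volume {x | c₂ / (T - s) < ‖curl (u s) x‖} ≤ ENNReal.ofReal (N * Real.sqrt (ν * (T - s)) ^ 3)) →
      ∃ K : ℝ, ∀ t ∈ Set.Ico 0 T,
        ∫⁻ x, ‖curl (u t) x‖ₑ ^ 2 ≤ ENNReal.ofReal (K / Real.sqrt (T - t)) := by
  intro c₂ hc₂ hc₂' ν T hν hT u p hmax hLH hdec hG hB
  obtain ⟨G, hGev⟩ := hG
  obtain ⟨N, hN⟩ := hB
  have hsol : IsClassicalNSSolutionOn (Ico 0 T) ν 0 u p := hmax.isClassicalNSSolutionOn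
  -- ### the rate window `(T₁, T)`, `T₁ ≥ 0`
  obtain ⟨T₁, hT₁T, hT₁0, hrate⟩ : ∃ T₁ < T, 0 ≤ T₁ ∧
      ∀ s ∈ Ioo T₁ T, ∀ x, ‖fderiv ℝ (u s) x‖ ≤ G / (T - s) := by
    obtain ⟨T₁, hT₁, hsub⟩ := mem_nhdsLT_iff_exists_Ioo_subset.1 hGev
    refine ⟨max T₁ 0, max_lt hT₁ hT, le_max_right _ _, fun s hs => hsub ⟨?_, hs.2⟩⟩
    exact lt_of_le_of_lt (le_max_left _ _) hs.1
  -- nonnegative majorants of the two constants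
  set G' : ℝ := max G 0 with hG'
  have hG'0 : 0 ≤ G' := le_max_right _ _
  have hGG' : G ≤ G' := le_max_left _ _
  set N' : ℝ := max N 0 with hN'
  have hN'0 : 0 ≤ N' := le_max_right _ _
  have hNN' : N ≤ N' := le_max_left _ _
  set κ : ℝ := ‖(curlCLM :
    (EuclideanSpace ℝ (Fin 3) →L[ℝ] EuclideanSpace ℝ (Fin 3)) →L[ℝ] EuclideanSpace ℝ (Fin 3))‖ with hκ
  set M₀ : ℝ := N' * Real.sqrt ν ^ 3 * κ ^ 2 * G' ^ 3 with hM₀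
  have hM₀0 : 0 ≤ M₀ := by positivity
  -- ### (1) the enstrophy budget along the solution
  obtain ⟨c, -, hbud⟩ := EnstrophyBudget.main
  obtain ⟨Zr, Pr, Sr, hZPS⟩ := hbud ν T hν hT u p hmax hLH hdec
  have hLS := EnstrophyBudget.isLocalSolution hν hT hsol hLH hdec
  -- ### (2) the growth inequality on the window
  have hgrowth : ∀ s ∈ Ioo T₁ T, 0 < s →
      2 * Sr s - 2 * ν * Pr s ≤ 2 * c₂ * Zr s / (T - s) + 2 * M₀ * (T - s) ^ (-(3 : ℝ) / 2) := by
    intro s hs hs0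
    have hsT : s ∈ Ioo 0 T := ⟨hs0, hs.2⟩
    have hsI : s ∈ Ico 0 T := ⟨hs0.le, hs.2⟩
    have hTs : 0 < T - s := sub_pos.2 hs.2
    obtain ⟨hZeq, hZ0, hP0, -, hSr, -, -⟩ := hZPS s hsT
    -- smoothness, Sobolev slices, divergence
    have hsm := hsol.contDiff_velocity hsI
    have hn : ∀ n : ℕ, ∫⁻ x, ‖iteratedFDeriv ℝ n (u s) x‖ₑ ^ 2 < ⊤ :=
      EnstrophyBudget.sobolev_slice hLS hsI
    have h0 : ∫⁻ x, ‖u s x‖ₑ ^ 2 < ⊤ := by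
      refine lt_of_le_of_lt (le_of_eq (lintegral_congr fun x => ?_)) (hn 0)
      rw [← ofReal_norm, ← ofReal_norm, norm_iteratedFDeriv_zero]
    have h2v : ContDiff ℝ 2 (u s) := hsm.of_le (by norm_cast)
    -- `Zr s = ∫ |curl u(s)|²`
    have hZint : Zr s = ∫ x, ‖curl (u s) x‖ ^ 2 := by
      have h := hZeq.symm.trans (lintegral_enorm_curl_sq_eq_ofReal_integral h2v (hn 1))
      exact (ENNReal.ofReal_eq_ofReal_iff hZ0 (integral_nonneg fun x => by positivity)).1 h
    -- the split on the slice `s`, threshold `c₂/(T−s)`, gradient bound `G'/(T−s)`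
    have hlam : 0 ≤ c₂ / (T - s) := div_nonneg hc₂.le hTs.le
    have hg : ∀ x, ‖fderiv ℝ (u s) x‖ ≤ G' / (T - s) := fun x =>
      (hrate s hs x).trans (div_le_div_of_nonneg_right hGG' hTs.le)
    have hWle : volume {x | c₂ / (T - s) < ‖curl (u s) x‖} ≤
        ENNReal.ofReal (N' * Real.sqrt (ν * (T - s)) ^ 3) :=
      (hN s hsI).trans (ENNReal.ofReal_le_ofReal
        (mul_le_mul_of_nonneg_right hNN' (pow_nonneg (Real.sqrt_nonneg _) 3)))
    have hW : volume {x | c₂ / (T - s) < ‖curl (u s) x‖} ≠ ⊤ :=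
      ne_top_of_le_ne_top ENNReal.ofReal_ne_top hWle
    have hvol : (volume {x | c₂ / (T - s) < ‖curl (u s) x‖}).toReal ≤ N' * Real.sqrt (ν * (T - s)) ^ 3 :=
      ENNReal.toReal_le_of_le_ofReal (by positivity) hWle
    have hsplit := stretch_le_split h2v (hsol.divFree s hsI) h0 (hn 1) (hn 2) hlam hg hW
    rw [← hSr, ← hZint] at hsplit
    -- the forcing term: `|W| κ² (G'/(T−s))³ ≤ M₀ (T−s)^{−3/2}`
    have hsq : Real.sqrt (ν * (T - s)) ^ 3 =
        Real.sqrt ν ^ 3 * ((T - s) ^ 3 * (T - s) ^ (-(3 : ℝ) / 2)) := by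
      rw [Real.sqrt_mul hν.le, mul_pow, sqrt_pow_three_eq_mul_rpow hTs]
    have hforce : (volume {x | c₂ / (T - s) < ‖curl (u s) x‖}).toReal * (κ ^ 2 * (G' / (T - s)) ^ 3) ≤
        M₀ * (T - s) ^ (-(3 : ℝ) / 2) := by
      calc (volume {x | c₂ / (T - s) < ‖curl (u s) x‖}).toReal * (κ ^ 2 * (G' / (T - s)) ^ 3)
          ≤ N' * Real.sqrt (ν * (T - s)) ^ 3 * (κ ^ 2 * (G' / (T - s)) ^ 3) :=
            mul_le_mul_of_nonneg_right hvol (by positivity)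
        _ = M₀ * (T - s) ^ (-(3 : ℝ) / 2) := by
            rw [hsq, div_pow, hM₀]
            field_simp
    -- assemble: `Z′ = 2S − 2νP ≤ 2S ≤ 2c₂ Z/(T−s) + 2M₀ (T−s)^{−3/2}`
    have hS : Sr s ≤ c₂ / (T - s) * Zr s + M₀ * (T - s) ^ (-(3 : ℝ) / 2) := hsplit.trans (by linarith)
    have hνP : 0 ≤ 2 * ν * Pr s := by positivity
    have e : 2 * c₂ * Zr s / (T - s) = 2 * (c₂ / (T - s) * Zr s) := by ring
    rw [e]
    linarith
  -- ### (3) the ODE half on `[t₀, T)`, `t₀ = (T₁ + T)/2`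
  set t₀ : ℝ := (T₁ + T) / 2 with ht₀
  have ht₀pos : 0 < t₀ := by rw [ht₀]; linarith
  have ht₀T : t₀ < T := by rw [ht₀]; linarith
  have ht₀T₁ : T₁ < t₀ := by rw [ht₀]; linarith
  have ha : 2 * c₂ < 1 / 2 := by linarith
  have hcont : ContinuousOn Zr (Ico t₀ T) := fun s hs =>
    (hZPS s ⟨ht₀pos.trans_le hs.1, hs.2⟩).2.2.2.2.2.1.continuousAt.continuousWithinAt
  have hderiv : ∀ s ∈ Ioo t₀ T, HasDerivAt Zr ((fun s => 2 * Sr s - 2 * ν * Pr s) s) s := fun s hs =>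
    (hZPS s ⟨ht₀pos.trans hs.1, hs.2⟩).2.2.2.2.2.1
  have hnn : ∀ s ∈ Ico t₀ T, 0 ≤ Zr s := fun s hs => (hZPS s ⟨ht₀pos.trans_le hs.1, hs.2⟩).2.1
  have hgr : ∀ s ∈ Ioo t₀ T, (fun s => 2 * Sr s - 2 * ν * Pr s) s ≤
      2 * c₂ * Zr s / (T - s) + 2 * M₀ * (T - s) ^ (-(3 : ℝ) / 2) := fun s hs =>
    hgrowth s ⟨ht₀T₁.trans hs.1, hs.2⟩ (ht₀pos.trans hs.1)
  have hODE := sliceBound_of_absorbedGrowth_from ht₀T ha (by positivity : (0 : ℝ) ≤ 2 * M₀) hcont hderiv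
    hnn hgr
  set K₁ : ℝ := Real.sqrt (T - t₀) * Zr t₀ + 2 * M₀ / (1 / 2 - 2 * c₂) with hK₁
  -- ### (4) the early slab `[0, t₀]`
  obtain ⟨B₀, hB₀0, hB₀⟩ := SparseSieve.earlySlab_enstrophy_bound hν hsol hLH hdec ht₀pos ht₀T
  -- ### the constant
  set K : ℝ := max K₁ (B₀ * Real.sqrt T) with hK
  refine ⟨K, fun t ht => ?_⟩
  have hTt : 0 < T - t := sub_pos.2 ht.2
  have hsq : 0 < Real.sqrt (T - t) := Real.sqrt_pos.2 hTt
  by_cases htt : t < t₀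
  · -- early times
    refine (hB₀ t ⟨ht.1, htt.le⟩).trans (ENNReal.ofReal_le_ofReal ?_)
    rw [le_div_iff₀ hsq]
    calc B₀ * Real.sqrt (T - t) ≤ B₀ * Real.sqrt T :=
          mul_le_mul_of_nonneg_left (Real.sqrt_le_sqrt (by linarith [ht.1])) hB₀0
      _ ≤ K := le_max_right _ _
  · -- late times: the ODE bound
    have htI : t ∈ Ico t₀ T := ⟨not_lt.1 htt, ht.2⟩
    have hZeq := (hZPS t ⟨ht₀pos.trans_le htI.1, ht.2⟩).1
    rw [hZeq]
    refine ENNReal.ofReal_le_ofReal ((hODE t htI).trans ?_)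
    exact div_le_div_of_nonneg_right (le_max_left _ _) hsq.le

end Summit.NavierStokesRegularity.NavierStokesRegularity.Theorems.EnstrophyQuarterLaw.LambBudget

end
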